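import Summits.QuantumFields.YangMills.Theorems.LuscherReductionTwistedTraceScalingCombFlat
import Summits.QuantumFields.YangMills.Theorems.LuscherReductionOneSiteLevelsKacChart
import HarnessLib

/-!
# Axis rotation: a common-axis family in `SU(2)` is simultaneously conjugate to the diagonal torus
# (lane A of S-BASE, crux `TwistedTraceScaling` stmt-QuantumFields-20203; layer 4b of the comb propagation behind `ValleyLinkProxAt`, design note
# `pub/ym-fleet/ym-luscher-20007-p1/COARSE-DESIGN.md` §16)

* `scalarPart_diagSU2`, `vecPart_diagSU2` — the parts of `diagSU2 φ` are `(cos φ, (sin φ, 0, 0))`;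
* `axisQuat n`, `axisRot n` — for a unit vector `n` with `n₀ ≥ 0` an explicit `R ∈ SU(2)` whose adjoint rotation maps `e₀ ↦ n`
  (`adRot_axisRot_mulVec_e0`); hence `R · diagSU2 φ · R⁻¹` has parts `(cos φ, sin φ • n)` (`parts_axisRot_conj_diagSU2`);
* ★★ `exists_conj_diagSU2` — for every unit `n` there is ONE `R` such that every `h ∈ SU(2)` with `vecPart h ∈ ℝ n` is `R · diagSU2 φ · R⁻¹`
  for some `φ` (the same `R` for the whole family — this is what turns a common-axis commuting triple of wraps into DIAGONAL wraps by a constant gauge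
  transformation).
HONEST FRAMING: linear algebra of `SU(2) → SO(3)` for a stub lane of a child of the CONDITIONAL reduction route (femto rung R2b1); not a gap, not Clay.
-/

set_option autoImplicit false

noncomputable section

open Matrix Real
open scoped Matrix BigOperators Quaternion
open Literature.MathematicalPhysics.QuantumFieldTheory
open Literature.MathematicalPhysics.QuantumLattice

namespace Summit.QuantumFields.YangMills.Theorems.FemtoTransferGap.TwoLattice.Flat

open Summit.QuantumFields.YangMills.Theorems.FemtoTransferGap
open Summit.QuantumFields.YangMills.Theorems.FemtoTransferGap.TwoLattice
open Summit.QuantumFields.YangMills.Theorems.FemtoTransferGap.TwoLattice.Toron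

/-! ## §1 Parts of the diagonal subgroup -/

/-- `scalarPart (diagSU2 φ) = cos φ`. [folklore] -/
theorem scalarPart_diagSU2 (φ : ℝ) : scalarPart (diagSU2 φ) = Real.cos φ := by
  rw [scalarPart_eq, coe_diagSU2]
  simp [Complex.exp_re, Complex.mul_re, Complex.mul_im]

/-- `vecPart (diagSU2 φ) = (sin φ, 0, 0)`. [folklore] -/
theorem vecPart_diagSU2 (φ : ℝ) : vecPart (diagSU2 φ) = ![Real.sin φ, 0, 0] := by
  ext a
  fin_cases a
  · simp [coe_diagSU2, Complex.exp_im, Complex.mul_re, Complex.mul_im]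
  · simp [coe_diagSU2]
  · simp [coe_diagSU2]

/-! ## §2 The explicit rotation taking `e₀` to a unit vector `n` with `n₀ ≥ 0` -/

/-- The unit quaternion `(p, 0, −n₂/(2p), n₁/(2p))`, `p = √((1+n₀)/2)`, whose adjoint rotation maps `e₀` to `n`. [cite: BrockerTomDieck1985, I (1.10)] -/
def axisQuat (n : Fin 3 → ℝ) : ℍ :=
  ⟨Real.sqrt ((1 + n 0) / 2), 0, -(n 2) / (2 * Real.sqrt ((1 + n 0) / 2)), n 1 / (2 * Real.sqrt ((1 + n 0) / 2))⟩

/-- The rotation `axisRot n := quatToSU2 (axisQuat n) ∈ SU(2)`. [cite: BrockerTomDieck1985, I (1.10)] -/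
def axisRot (n : Fin 3 → ℝ) : SU2 := quatToSU2 (axisQuat n)

/-- `p = √((1+n₀)/2)` is positive and `p² = (1+n₀)/2` when `n₀ ≥ 0`. [folklore] -/
theorem axisQuat_p_pos {n : Fin 3 → ℝ} (h0 : 0 ≤ n 0) :
    0 < Real.sqrt ((1 + n 0) / 2) ∧ Real.sqrt ((1 + n 0) / 2) ^ 2 = (1 + n 0) / 2 :=
  ⟨Real.sqrt_pos.2 (by linarith), Real.sq_sqrt (by linarith)⟩

/-- `axisQuat n` is a unit quaternion for a unit vector `n` with `n₀ ≥ 0`. [folklore] -/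
theorem normSq_axisQuat {n : Fin 3 → ℝ} (hn : ∑ a, n a ^ 2 = 1) (h0 : 0 ≤ n 0) : Quaternion.normSq (axisQuat n) = 1 := by
  obtain ⟨hp, hp2⟩ := axisQuat_p_pos h0
  set p := Real.sqrt ((1 + n 0) / 2) with hpdef
  rw [Fin.sum_univ_three] at hn
  rw [Quaternion.normSq_def']
  simp only [axisQuat]
  rw [← hpdef]
  have hp0 : p ≠ 0 := hp.ne'
  field_simp
  nlinarith [hp2, hn]

/-- `‖axisQuat n‖ = 1`. [folklore] -/
theorem norm_axisQuat {n : Fin 3 → ℝ} (hn : ∑ a, n a ^ 2 = 1) (h0 : 0 ≤ n 0) : ‖axisQuat n‖ = 1 := by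
  have h := normSq_axisQuat hn h0
  rw [Quaternion.normSq_eq_norm_mul_self] at h
  nlinarith [norm_nonneg (axisQuat n)]

/-- The matrix of `axisRot n`. [folklore] -/
theorem coe_axisRot {n : Fin 3 → ℝ} (hn : ∑ a, n a ^ 2 = 1) (h0 : 0 ≤ n 0) :
    (axisRot n : Matrix (Fin 2) (Fin 2) ℂ) = quatMatrix (axisQuat n) :=
  coe_quatToSU2_of_norm_eq_one (norm_axisQuat hn h0)

/-- Column `0` of `Ad(V)` in terms of the matrix entries `p + iq = V₀₀`, `r + is = V₀₁`. [cite: BrockerTomDieck1985, I (1.10)] -/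
theorem adRot_col_zero (V : SU2) :
    adRot V 0 0 = ((V : Matrix (Fin 2) (Fin 2) ℂ) 0 0).re ^ 2 + ((V : Matrix (Fin 2) (Fin 2) ℂ) 0 0).im ^ 2
        - ((V : Matrix (Fin 2) (Fin 2) ℂ) 0 1).re ^ 2 - ((V : Matrix (Fin 2) (Fin 2) ℂ) 0 1).im ^ 2 ∧
      adRot V 1 0 = 2 * (((V : Matrix (Fin 2) (Fin 2) ℂ) 0 0).im * ((V : Matrix (Fin 2) (Fin 2) ℂ) 0 1).re
        + ((V : Matrix (Fin 2) (Fin 2) ℂ) 0 0).re * ((V : Matrix (Fin 2) (Fin 2) ℂ) 0 1).im) ∧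
      adRot V 2 0 = 2 * (((V : Matrix (Fin 2) (Fin 2) ℂ) 0 0).im * ((V : Matrix (Fin 2) (Fin 2) ℂ) 0 1).im
        - ((V : Matrix (Fin 2) (Fin 2) ℂ) 0 0).re * ((V : Matrix (Fin 2) (Fin 2) ℂ) 0 1).re) := by
  refine ⟨?_, ?_, ?_⟩ <;> simp [adRot]

/-- `Ad(V)·(c e₀) = c · (column 0 of Ad(V))`. [folklore] -/
theorem adRot_mulVec_e0 (V : SU2) (c : ℝ) : (adRot V).mulVec ![c, 0, 0] = fun a => c * adRot V a 0 := by
  ext a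
  simp [Matrix.mulVec, dotProduct, Fin.sum_univ_three, mul_comm]

/-- ★ **`Ad(axisRot n)` maps `c·e₀` to `c·n`.** [cite: BrockerTomDieck1985, I (1.10)] -/
theorem adRot_axisRot_mulVec_e0 {n : Fin 3 → ℝ} (hn : ∑ a, n a ^ 2 = 1) (h0 : 0 ≤ n 0) (c : ℝ) :
    (adRot (axisRot n)).mulVec ![c, 0, 0] = c • n := by
  obtain ⟨hp, hp2⟩ := axisQuat_p_pos h0
  set p := Real.sqrt ((1 + n 0) / 2) with hpdef
  have hp0 : p ≠ 0 := hp.ne'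
  have hn3 := hn
  rw [Fin.sum_univ_three] at hn3
  have hM : (axisRot n : Matrix (Fin 2) (Fin 2) ℂ) = quatMatrix (axisQuat n) := coe_axisRot hn h0
  have e00r : ((axisRot n : Matrix (Fin 2) (Fin 2) ℂ) 0 0).re = p := by rw [hM]; simp [quatMatrix, axisQuat, hpdef]
  have e00i : ((axisRot n : Matrix (Fin 2) (Fin 2) ℂ) 0 0).im = 0 := by rw [hM]; simp [quatMatrix, axisQuat]
  have e01r : ((axisRot n : Matrix (Fin 2) (Fin 2) ℂ) 0 1).re = -(n 2) / (2 * p) := by rw [hM]; simp [quatMatrix, axisQuat, hpdef]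
  have e01i : ((axisRot n : Matrix (Fin 2) (Fin 2) ℂ) 0 1).im = n 1 / (2 * p) := by rw [hM]; simp [quatMatrix, axisQuat, hpdef]
  obtain ⟨c0, c1, c2⟩ := adRot_col_zero (axisRot n)
  rw [e00r, e00i, e01r, e01i] at c0 c1 c2
  have key0 : adRot (axisRot n) 0 0 = n 0 := by
    rw [c0]
    field_simp
    nlinarith [hp2, hn3]
  have key1 : adRot (axisRot n) 1 0 = n 1 := by
    rw [c1]
    field_simp
    ring
  have key2 : adRot (axisRot n) 2 0 = n 2 := by
    rw [c2]
    field_simp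
    ring
  rw [adRot_mulVec_e0]
  ext a
  simp only [Pi.smul_apply, smul_eq_mul]
  fin_cases a
  · show c * adRot (axisRot n) 0 0 = c * n 0
    rw [key0]
  · show c * adRot (axisRot n) 1 0 = c * n 1
    rw [key1]
  · show c * adRot (axisRot n) 2 0 = c * n 2
    rw [key2]

/-- ★ **Parts of `R · diagSU2 φ · R⁻¹` for `R = axisRot n`**: `(cos φ, sin φ • n)`. [cite: BrockerTomDieck1985, I (1.10)] -/
theorem parts_axisRot_conj_diagSU2 {n : Fin 3 → ℝ} (hn : ∑ a, n a ^ 2 = 1) (h0 : 0 ≤ n 0) (φ : ℝ) :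
    scalarPart (axisRot n * diagSU2 φ * (axisRot n)⁻¹) = Real.cos φ ∧
      vecPart (axisRot n * diagSU2 φ * (axisRot n)⁻¹) = Real.sin φ • n := by
  refine ⟨by rw [scalarPart_conj, scalarPart_diagSU2], ?_⟩
  rw [vecPart_conj, vecPart_diagSU2, adRot_axisRot_mulVec_e0 hn h0]

/-! ## §3 Simultaneous conjugation of a common-axis family to the diagonal torus -/

/-- For a unit `n` with `n₀ ≥ 0`: every `h` with `vecPart h = t • n` is `axisRot n · diagSU2 φ · (axisRot n)⁻¹`. [cite: BrockerTomDieck1985, IV (2.2)] -/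
theorem exists_conj_diagSU2_of_nonneg {n : Fin 3 → ℝ} (hn : ∑ a, n a ^ 2 = 1) (h0 : 0 ≤ n 0) (h : SU2) (t : ℝ)
    (ht : vecPart h = t • n) : ∃ φ : ℝ, h = axisRot n * diagSU2 φ * (axisRot n)⁻¹ := by
  have hsq : scalarPart h ^ 2 + t ^ 2 = 1 := by
    have h1 := scalarPart_sq_add h
    rw [ht] at h1
    have h2 : ∑ a, (t • n) a ^ 2 = t ^ 2 := by
      simp only [Pi.smul_apply, smul_eq_mul, mul_pow]
      rw [← Finset.mul_sum, hn, mul_one]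
    rw [h2] at h1
    exact h1
  -- the angle from the parts (`cos (arg (s + t i)) = s`, `sin (arg (s + t i)) = t`; cf. `…Mopup.exists_cos_eq_and_sin_eq`)
  obtain ⟨φ, hc, hs⟩ : ∃ φ : ℝ, Real.cos φ = scalarPart h ∧ Real.sin φ = t := by
    set z : ℂ := ⟨scalarPart h, t⟩ with hz
    have hnorm : ‖z‖ = 1 := by
      have h2 : ‖z‖ ^ 2 = 1 := by
        rw [Complex.sq_norm, Complex.normSq_apply]
        simp only [hz]
        nlinarith [hsq]
      nlinarith [norm_nonneg z, h2]
    have hz0 : z ≠ 0 := by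
      intro h0; rw [h0, norm_zero] at hnorm; exact zero_ne_one hnorm
    refine ⟨Complex.arg z, ?_, ?_⟩
    · rw [Complex.cos_arg hz0, hnorm, div_one]
    · rw [Complex.sin_arg, hnorm, div_one]
  obtain ⟨hsc, hvec⟩ := parts_axisRot_conj_diagSU2 hn h0 φ
  refine ⟨φ, eq_of_scalarPart_eq_of_vecPart_eq ?_ ?_⟩
  · rw [hsc, hc]
  · rw [hvec, hs, ht]

/-- ★★ **Simultaneous conjugation to the diagonal torus.** For every unit vector `n` there is ONE `R ∈ SU(2)` such that every `h ∈ SU(2)` whose vector part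
lies on the axis `ℝ n` equals `R · diagSU2 φ · R⁻¹` for some angle `φ`. Applied to a common-axis commuting family (`…AlmostCommutingSU2`,
`exists_common_axis_triple_near`) it diagonalises the whole family by the SAME constant gauge rotation. [cite: BrockerTomDieck1985, IV (2.2)] -/
theorem exists_conj_diagSU2 {n : Fin 3 → ℝ} (hn : ∑ a, n a ^ 2 = 1) :
    ∃ R : SU2, ∀ (h : SU2) (t : ℝ), vecPart h = t • n → ∃ φ : ℝ, h = R * diagSU2 φ * R⁻¹ := by
  by_cases h0 : 0 ≤ n 0
  · exact ⟨axisRot n, fun h t ht => exists_conj_diagSU2_of_nonneg hn h0 h t ht⟩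
  · have hn' : ∑ a, (-n) a ^ 2 = 1 := by
      simp only [Pi.neg_apply, neg_sq]; exact hn
    have h0' : 0 ≤ (-n) 0 := by simp only [Pi.neg_apply]; linarith [not_le.1 h0]
    refine ⟨axisRot (-n), fun h t ht => exists_conj_diagSU2_of_nonneg hn' h0' h (-t) ?_⟩
    rw [ht, smul_neg, neg_smul, neg_neg]

/-- **Family version**: a family `A : ι → SU(2)` with all vector parts on one axis `ℝ n` (`n` a unit vector) is simultaneously conjugate to the diagonal
torus: `A i = R · diagSU2 (φ i) · R⁻¹`. [cite: BrockerTomDieck1985, IV (2.2)] -/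
theorem exists_conj_diagSU2_family {ι : Type*} {n : Fin 3 → ℝ} (hn : ∑ a, n a ^ 2 = 1) (A : ι → SU2)
    (hA : ∀ i, ∃ t : ℝ, vecPart (A i) = t • n) : ∃ (R : SU2) (φ : ι → ℝ), ∀ i, A i = R * diagSU2 (φ i) * R⁻¹ := by
  obtain ⟨R, hR⟩ := exists_conj_diagSU2 hn
  have hex : ∀ i, ∃ φ : ℝ, A i = R * diagSU2 φ * R⁻¹ := fun i => by
    obtain ⟨t, ht⟩ := hA i
    exact hR (A i) t ht
  choose φ hφ using hex
  exact ⟨R, φ, hφ⟩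

/-- **Degenerate axis**: if the would-be axis vanishes the family is central, hence already diagonal (`vecPart = 0 ⇒ h = diagSU2 0` or `diagSU2 π`);
packaged as: a family with `vecPart (A i) = t_i • n` for SOME `n` (unit or not) is simultaneously conjugate to the diagonal torus. [folklore] -/
theorem exists_conj_diagSU2_family' {ι : Type*} (n : Fin 3 → ℝ) (A : ι → SU2)
    (hA : ∀ i, ∃ t : ℝ, vecPart (A i) = t • n) : ∃ (R : SU2) (φ : ι → ℝ), ∀ i, A i = R * diagSU2 (φ i) * R⁻¹ := by
  by_cases hn0 : ∑ a, n a ^ 2 = 0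
  · -- `n = 0`: every `A i` is central, `vecPart (A i) = 0 = 0 • e₀`
    have hna : ∀ a, n a = 0 := fun a => by
      have := (Finset.sum_eq_zero_iff_of_nonneg (fun b _ => sq_nonneg (n b))).1 hn0 a (Finset.mem_univ a)
      exact pow_eq_zero_iff (n := 2) (by norm_num) |>.1 this
    have he0 : ∑ a, (![1, 0, 0] : Fin 3 → ℝ) a ^ 2 = 1 := by simp [Fin.sum_univ_three]
    refine exists_conj_diagSU2_family he0 A fun i => ⟨0, ?_⟩
    obtain ⟨t, ht⟩ := hA i
    rw [ht, zero_smul]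
    ext a
    simp [hna a]
  · -- normalise `n`
    set m : ℝ := Real.sqrt (∑ a, n a ^ 2) with hm
    have hpos : 0 < ∑ a, n a ^ 2 := lt_of_le_of_ne (Finset.sum_nonneg fun b _ => sq_nonneg (n b)) (Ne.symm hn0)
    have hm0 : 0 < m := Real.sqrt_pos.2 hpos
    have hm2 : m ^ 2 = ∑ a, n a ^ 2 := Real.sq_sqrt hpos.le
    have hunit : ∑ a, (m⁻¹ • n) a ^ 2 = 1 := by
      simp only [Pi.smul_apply, smul_eq_mul, mul_pow]
      rw [← Finset.mul_sum, ← hm2, inv_pow, inv_mul_cancel₀ (pow_ne_zero 2 hm0.ne')]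
    refine exists_conj_diagSU2_family hunit A fun i => ?_
    obtain ⟨t, ht⟩ := hA i
    refine ⟨t * m, ?_⟩
    rw [ht, smul_smul, mul_assoc, mul_inv_cancel₀ hm0.ne', mul_one]

end Summit.QuantumFields.YangMills.Theorems.FemtoTransferGap.TwoLattice.Flat

end
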